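import Literature.MathematicalPhysics.QuantumFieldTheory.Balaban1983to89.Node00.TorusCoverLandau153
import Literature.MathematicalPhysics.QuantumFieldTheory.Balaban1983to89.Node00.TorusCoverGaugeTokensR10

/-!
# NODE 00 — THE (152) STEP ON EVERY GRID CUBE OF A CLASS MEMBER WITH ALL FOUR PRINTED LETTERS AND THE GAUGE CONDITION (153) OF THE LIFT:
# 34c's `gauge152R10_of_prop6` (⟸ [6] Proposition 6 at NODE 00's `ℤᵈ` member) re-run through `exists_localGauge152_153_cube_of_prop6`

Cell `pub-ymgap`, width seat `pub-ymgap-dag-n07-w3` generation 0 (HUMAN RULING D-0149 ∕ director-ym №197; DAG node N07 = [15]; plan g77 W-SEAT-START-LIST v3 § n07 item S3; cell INBOX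
INTENT-2 of 2026-08-27).  NEW leaf, PROOF kind (no `def`); CONSUMED BY NAME, nothing modified: this seat's `Node00.TorusCoverLandau153` (`exists_localGauge152_153_cube_of_prop6`),
34c `Node00.TorusCoverGaugeTokensR10` and FILE 29 `Node00.TorusCoverGaugeTokensR` (the binder block of `Gauge152OfClassTopStepR10`, the constants `b9Of`, `a0Of`, `a0Of_pos`,
`boxWidth_propCube`, `cover_image_Ω_cubeIdx'_one_subset_hullD`), FILE 26 (`cover_image_Ω_cubeIdx'_subset`, `propCube_M ∕ _k`), N05's `B8Eq138LandauZd.isLandau138_zero`, def-R's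
`suppDomOfRecord`.  `--kind proof --supports stmt-QuantumFields-20542 --as helper` (K1⁷; count-neutral).
[15] = [Balaban1985Variational]; [6] = [Balaban1985RegularSpaces]; [III] = [Balaban1988Convergent].

WHY.  34c's ★★★ `gauge152R10_of_prop6` delivers, for every member `U` of the (1.7)∕(1.9)-Top class on a separated index with the floor `(11·4 + 3L)·L ≤ M₁`, on every
non-wrapping grid cube of the two families at scale `n`, the clause `Sect2.LocalGauge10On □ η_n (b9Of·ε_n) U` — [15] (152)'s letters `|A|, |∇A|, |∂*∂A|`.  Print's (152) has a
fourth member `(L^jη)³|Δ^ηA|` and is followed by the gauge condition (153) «R ∂^{η*}A = 0»; `Node00.TorusCoverLandau153` carries both through the cube push-down.  This file is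
the families-level wrapper: 34c's proof VERBATIM (the empty cube at `M = 0`; the generic cube letter `M₀ ∈ {M, LM}` at scale `n`; the collar clause from `Sect2.SeqSeparated` ∕
the hull at `n = 1` under the floor; print's «7dL²M′α₀ ≤ c₁» and the `2π`-window from `ε_{n−1} ≤ a0Of`; the letters at `2r < b9Of·ε_n` from `ε_{n−1} ≤ 2ε_n`) with the richer
one-cube theorem, SAME constants `b9Of`, `a0Of`, SAME floor — the two extra clauses cost nothing new.  The second family is stated at scale `n` with the cube letter `LM`
(`side L M (n+1) = side L (LM) n`, 34c's `hside`).

CONTENTS.  §1 ★★★ `gauge152_153_of_prop6`.  §2 ★★ `gauge9_152_153_of_prop8TopStep_of_prop6` (the same for CRITICAL configurations at the radii `B₃δ_•` of [15] (8), ⟸ stub 1's fact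
`Prop8RegSepTopStep` as HYPOTHESIS — [15] Thm 1 (9) line 1 + (10) BOTH members + the gauge condition of (9)'s `u` for the lift).

HONEST FRAMING: a composition by name; [6] Proposition 6 at the member is the HYPOTHESIS `hP6` (N05's node; never asserted here); (153) stays in N05's `ℤᵈ` multiplier currency
for the LIFT on the collared cube (no torus-native `R`); the Laplacian member is in r11's `grad` letters (inline, as in `TorusCoverLandau153`); nothing of Bałaban discharged;
K0⁷ ∕ K1⁷ NOT closed; N07 ∕ N05 NOT discharged; counts unmoved (5∕27); one finite T⁴ programme at fixed ε — NOT continuum ∕ ℝ⁴ ∕ infinite volume ∕ OS ∕ mass gap ∕ Clay.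
No `sorry`, no `def`, no `instance`, no `notation`.
-/

noncomputable section

namespace Literature.MathematicalPhysics.QuantumFieldTheory.Balaban1983to89.Node00

open scoped Matrix.Norms.L2Operator
open T4Continuum (T4Family)
open B15DeterminingSets B12RegularSpaces111
open B15Eq112TorusCover (cover)
open B14DomainGeom (Pt)
open B14.Eq213MaximalDomains (side cubeExt)
open B7Prop1Explicit (e)
open B8Eq131Cubes (box tcube bLo bHi)
open B8LeafModelZd (ZdIdx)
open B8Eq138LandauZd (IsLandau138 isLandau138_zero)

variable {F : T4Family} {N : ℕ} [NeZero N]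

/-- ★★★ **[15] (152) WITH ALL FOUR LETTERS AND (153) FOR THE LIFT, ON EVERY GRID CUBE OF A CLASS MEMBER ⟸ [6] PROP. 6 AT THE MEMBER** — 34c's `gauge152R10_of_prop6` binder
block (a separated index `s` with the floor `(11·4 + 3L)·L ≤ ν.M₁` — the token's binders `0 < ν.M₁`, `1 ≤ k` and the downward comparability are not needed and dropped;
level radii `0 < ε_m ≤ a0Of F N M B₁ c₁` with `ε_m ≤ 2ε_{m+1}`; `U` in the
(1.7)∕(1.9)-Top class over `suppDomOfRecord`; a scale `1 ≤ n ≤ k`; the cube letter `M₀ ∈ {M, L·M}` (the two families, the second written at scale `n`); a non-wrapping grid cube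
`□ = cubeEnl (F.P K) (LⁿM₀) a 0 ⊆ Ω_n`), CONCLUSION: an `SU(N)` gauge `u` and a potential `A` on `□` with `(ι∘U)^{ι∘u} = e^{iη_nA}`, `‖A‖ < b9Of·ε_n` on the bonds,
`‖∇^{η_n}A‖ < b9Of·ε_n` on the stencils, `‖∂^{η_n*}∂^{η_n}A‖ < b9Of·ε_n` AND `‖Δ^{η_n}A‖ < b9Of·ε_n` (r11's `grad` letters, inline) on the deep bonds of `□` — [15] (152)'s four
members — AND a `ℤᵈ` potential `A′` with `A ⟨π x, μ⟩ = A′ x μ` on the lifted cube, in the (153)-gauge `IsLandau138 L c.k η_n (c.sq 0) c.lamS 1 A′` of the Prop.-6 cube datum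
`c = propCube (F.P K) n hn M₀ a`.  Prop. 6 at the member is the HYPOTHESIS `hP6`. [cite: Balaban1985Variational, (144)–(153) pp.300–301, Thm 1 (10) p.279; Balaban1985RegularSpaces, Prop. 6 (1.135)–(1.138) p.99; Balaban1988Convergent, (2.13) p.256] -/
theorem gauge152_153_of_prop6 {B₁ c₁ : ℝ} (hB₁ : 0 ≤ B₁) (hc₁ : 0 < c₁)
    (hP6 : letI : CStarAlgebra (MatA N) := {}; B8.Prop6Printed 4 (F.L : ℝ) B₁ c₁ (fun i : ZdIdx 4 F.L => zdCub (MatA N) F.L i)) (M : ℕ)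
    (ν : Stage7Numerics) (g : ℕ → ℝ) (K k : ℕ) (s : SeqOfRecord F ν M g K k) (hsep : Sect2.SeqSeparated ν.M₁ s)
    (hfloor : (11 * 4 + 3 * F.L) * F.L ≤ ν.M₁) (ε : ℕ → ℝ)
    (hε : ∀ m, m ≤ k → 0 < ε m ∧ ε m ≤ a0Of F N M B₁ c₁) (hcomp : ∀ m, m < k → ε m ≤ 2 * ε (m + 1))
    (U : GaugeField (F.P K) 0 (SU N))
    (h17 : ∀ m, m ≤ k → PlaqSmallOn (Sect2.omegaPlaqsTop s.Ω (suppDomOfRecord F ν K s.Ω) m) (ε m * (F.P K).eta m ^ 2) U)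
    (h19 : ∀ m, m ≤ k → Sect2.CoDivSmallOn (Sect2.omegaBondsTop s.Ω (suppDomOfRecord F ν K s.Ω) m) (ε m * (F.P K).eta m ^ 3) U)
    {n : ℕ} (hn1 : 1 ≤ n) (hnk : n ≤ k) {M₀ : ℕ} (hM₀ : M₀ = M ∨ M₀ = F.L * M)
    (hSN : ((side (F.P K).L M₀ n : ℕ) : ℤ) < (F.P K).sitesPerDir 0)
    (a : Pt (F.P K).d) (hΩ : cubeEnl (F.P K) (side (F.P K).L M₀ n) a 0 ⊆ s.Ω n) :
    ∃ u : GaugeTransf (F.P K) 0 (SU N), ∃ A : PBond (F.P K) 0 → MatA N,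
      (∀ b ∈ (Sect2.regionOfSet (F.P K) (cubeEnl (F.P K) (side (F.P K).L M₀ n) a 0)).bonds,
          gaugeU (fun x => ιSU N (u x)) (fun b' => ιSU N (U b')) b = expI ((F.P K).eta n) (A b)) ∧
      (∀ b ∈ (Sect2.regionOfSet (F.P K) (cubeEnl (F.P K) (side (F.P K).L M₀ n) a 0)).bonds, ‖A b‖ < b9Of F M B₁ * ε n) ∧
      (∀ q ∈ (Sect2.regionOfSet (F.P K) (cubeEnl (F.P K) (side (F.P K).L M₀ n) a 0)).dpairs,
          ‖grad ((F.P K).eta n) q.2.1 (fun y => A ⟨y, q.2.2⟩) q.1‖ < b9Of F M B₁ * ε n) ∧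
      (∀ b ∈ Sect2.bondsDeep (cubeEnl (F.P K) (side (F.P K).L M₀ n) a 0), ‖Sect2.codiffCurlA ((F.P K).eta n) A b.src b.dir‖ < b9Of F M B₁ * ε n) ∧
      (∀ b ∈ Sect2.bondsDeep (cubeEnl (F.P K) (side (F.P K).L M₀ n) a 0),
          ‖∑ ν' : Fin (F.P K).d, (((F.P K).eta n : ℝ) : ℂ)⁻¹ •
              (grad ((F.P K).eta n) ν' (fun y => A ⟨y, b.dir⟩) (b.src.unshift ν') - grad ((F.P K).eta n) ν' (fun y => A ⟨y, b.dir⟩) b.src)‖ <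
            b9Of F M B₁ * ε n) ∧
      ∃ A' : B7Prop1Explicit.Site (F.P K).d → Fin (F.P K).d → MatA N,
        (∀ x, x ∈ cubeExt (side (F.P K).L M₀ n) a 0 → ∀ μ, A ⟨cover (F.P K) x, μ⟩ = A' x μ) ∧
        IsLandau138 (F.P K).L (propCube (F.P K) n hn1 M₀ a).k ((F.P K).eta n) ((propCube (F.P K) n hn1 M₀ a).sq 0) (propCube (F.P K) n hn1 M₀ a).lamS
          (1 : B7Prop1Explicit.Site (F.P K).d → Fin (F.P K).d → (MatA N)ˣ) A' := by
  letI : CStarAlgebra (MatA N) := {}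
  have hL2 : 2 ≤ F.L := (F.P 0).hL.2
  have hd : 2 ≤ (F.P K).d := by rw [T4Family.P_d]; norm_num
  set M₂ : ℕ := F.L * M + 44 + F.L with hM₂
  have ha₀ := a0Of_pos (F := F) (N := N) M hB₁ hc₁
  have hεn : 0 < ε n := (hε n hnk).1
  have hbpos : 0 < b9Of F M B₁ * ε n := by
    have : 0 < b9Of F M B₁ := by unfold b9Of; positivity
    exact mul_pos this hεn
  -- the case `M = 0`: the cube is empty; the (153)-gauge of the lift is witnessed by the zero potential
  rcases Nat.eq_zero_or_pos M with hM0 | hMpos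
  · subst hM0
    have hM₀0 : M₀ = 0 := by rcases hM₀ with h | h <;> simp [h]
    subst hM₀0
    have hS0 : side (F.P K).L 0 n = 0 := by simp [side]
    have hempty : ∀ y, y ∉ cubeEnl (F.P K) (side (F.P K).L 0 n) a 0 := by
      rw [hS0]
      rintro y ⟨z, hz, -⟩
      have h0 := hz ⟨0, by rw [T4Family.P_d]; norm_num⟩
      simp only [Nat.cast_zero, zero_mul, sub_zero, add_zero] at h0
      omega
    have hempty' : ∀ x, x ∉ cubeExt (side (F.P K).L 0 n) a 0 := by
      rw [hS0]
      intro x hx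
      have h0 := hx ⟨0, by rw [T4Family.P_d]; norm_num⟩
      simp only [Nat.cast_zero, zero_mul, sub_zero, add_zero] at h0
      omega
    exact ⟨fun _ => 1, fun _ => 0, fun b hb => (hempty _ hb.1).elim, fun b hb => (hempty _ hb.1).elim, fun q hq => (hempty _ hq.1).elim,
      fun b hb => (hempty _ hb.1).elim, fun b hb => (hempty _ hb.1).elim, 0, fun x hx => (hempty' x hx).elim, isLandau138_zero _ _ _ _ _ _⟩
  -- `M ≥ 1`: the cube letter `M₀ ∈ {M, LM}` is positive and at most `M₂ − 44 − L`
  have hM₀pos : 1 ≤ M₀ := by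
    rcases hM₀ with h | h
    · rw [h]; exact hMpos
    · rw [h]; exact Nat.one_le_iff_ne_zero.2 (Nat.mul_ne_zero (F.P 0).L_pos.ne' hMpos.ne')
  have hM₀' : M₀ + 44 + F.L ≤ M₂ := by
    rcases hM₀ with h | h
    · rw [h, hM₂]; nlinarith [(F.P 0).L_pos]
    · rw [h, hM₂]
  have hεn1 : 0 < ε (n - 1) := (hε (n - 1) (by omega)).1
  have hεn1a : ε (n - 1) ≤ a0Of F N M B₁ c₁ := (hε (n - 1) (by omega)).2
  have hε2 : ε (n - 1) ≤ 2 * ε n := by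
    have := hcomp (n - 1) (by omega)
    rwa [show n - 1 + 1 = n by omega] at this
  have hM₂pos : (0 : ℝ) < M₂ := by positivity
  -- the collar clause
  have hcollar : cover (F.P K) '' (cubeIdx' (F.P K) n hn1 M₀ a).Ω 0 ⊆
      (if n - 1 = 0 then suppDomOfRecord F ν K s.Ω else s.Ω (n - 1)) := by
    rcases Nat.eq_or_lt_of_le hn1 with h1 | h1
    · subst h1
      rw [if_pos rfl, suppDomOfRecord_eq]
      exact cover_image_Ω_cubeIdx'_one_subset_hullD (by rw [T4Family.P_d, T4Family.P_L]; exact hfloor) hM₀pos a hΩ 0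
    · rw [if_neg (by omega)]
      refine cover_image_Ω_cubeIdx'_subset (F.P K) s hsep ?_ h1 hnk hM₀pos a hΩ 0
      rw [T4Family.P_d, T4Family.P_L]
      exact le_trans (Nat.le_mul_of_pos_right _ (F.P 0).L_pos) hfloor
  -- the smallness «7dL²M′α₀ ≤ c₁»
  have ha₀c : a0Of F N M B₁ c₁ ≤ c₁ / (56 * (F.L : ℝ) ^ 5 * M₂) := by rw [hM₂]; exact min_le_left _ _
  have ha₀w : a0Of F N M B₁ c₁ ≤ 1 / (8 * (M₂ : ℝ) * N * (28 * (F.L : ℝ) ^ 5 * B₁ * M₂) + 1) := by rw [hM₂]; exact min_le_right _ _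
  have hc₁' : 7 * (F.P K).d * ((F.P K).L : ℝ) ^ 2 * (propCube (F.P K) n hn1 M₀ a).M * (((F.P K).L : ℝ) ^ 3 * ε (n - 1)) ≤ c₁ := by
    rw [propCube_M, T4Family.P_d, T4Family.P_L]
    have h1 : 7 * (4 : ℕ) * (F.L : ℝ) ^ 2 * ((M₀ + 11 * 4 + F.L : ℕ) : ℝ) * ((F.L : ℝ) ^ 3 * ε (n - 1)) ≤ 28 * (F.L : ℝ) ^ 5 * M₂ * a0Of F N M B₁ c₁ := by
      have : 7 * (4 : ℕ) * (F.L : ℝ) ^ 2 * ((M₀ + 11 * 4 + F.L : ℕ) : ℝ) * ((F.L : ℝ) ^ 3 * ε (n - 1)) =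
          28 * (F.L : ℝ) ^ 5 * ((M₀ + 11 * 4 + F.L : ℕ) : ℝ) * ε (n - 1) := by push_cast; ring
      rw [this]
      have hM₀r : ((M₀ + 11 * 4 + F.L : ℕ) : ℝ) ≤ (M₂ : ℝ) := by exact_mod_cast (by omega : M₀ + 11 * 4 + F.L ≤ M₂)
      gcongr
    have h2 : 28 * (F.L : ℝ) ^ 5 * M₂ * a0Of F N M B₁ c₁ ≤ 28 * (F.L : ℝ) ^ 5 * M₂ * (c₁ / (56 * (F.L : ℝ) ^ 5 * M₂)) :=
      mul_le_mul_of_nonneg_left ha₀c (by positivity)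
    have h3 : 28 * (F.L : ℝ) ^ 5 * M₂ * (c₁ / (56 * (F.L : ℝ) ^ 5 * M₂)) = c₁ / 2 := by field_simp; ring
    linarith
  -- the `2π`-window of the normalisation
  have h2π : (2 * boxWidth (bLo (F.P K).L (propCube (F.P K) n hn1 M₀ a).a (propCube (F.P K) n hn1 M₀ a).k 0)
      (bHi (F.P K).L (propCube (F.P K) n hn1 M₀ a).a (propCube (F.P K) n hn1 M₀ a).M (propCube (F.P K) n hn1 M₀ a).k 0) + 1) *
      ((F.P K).eta n * N * (7 * (F.P K).d * ((F.P K).L : ℝ) ^ 2 * B₁ * (propCube (F.P K) n hn1 M₀ a).M * (((F.P K).L : ℝ) ^ 3 * ε (n - 1)) *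
        (((F.P K).L : ℝ) ^ (propCube (F.P K) n hn1 M₀ a).k * (F.P K).eta n)⁻¹)) < 2 * Real.pi := by
    rw [boxWidth_propCube, propCube_M, propCube_k, B12Eq115BackgroundPair.pow_mul_eta, inv_one, mul_one, T4Family.P_d, T4Family.P_L]
    have hη : (F.L : ℝ) ^ n * (F.P K).eta n = 1 := by have := B12Eq115BackgroundPair.pow_mul_eta (F.P K) n; rwa [T4Family.P_L] at this
    have hηpos : 0 < (F.P K).eta n := B3GkZeroTorusRescaled.eta_pos (F.P K) n
    have hW : (2 * ((4 : ℕ) * ((F.L : ℝ) ^ n * ((M₀ + 11 * 4 + F.L : ℕ) : ℝ) - 1)) + 1) * (F.P K).eta n ≤ 8 * ((M₀ + 11 * 4 + F.L : ℕ) : ℝ) := by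
      have : (2 * ((4 : ℕ) * ((F.L : ℝ) ^ n * ((M₀ + 11 * 4 + F.L : ℕ) : ℝ) - 1)) + 1) * (F.P K).eta n =
          8 * ((M₀ + 11 * 4 + F.L : ℕ) : ℝ) * ((F.L : ℝ) ^ n * (F.P K).eta n) - 7 * (F.P K).eta n := by push_cast; ring
      rw [this, hη, mul_one]; linarith
    have hM₀r : ((M₀ + 11 * 4 + F.L : ℕ) : ℝ) ≤ (M₂ : ℝ) := by exact_mod_cast (by omega : M₀ + 11 * 4 + F.L ≤ M₂)
    have hr : 7 * (4 : ℕ) * (F.L : ℝ) ^ 2 * B₁ * ((M₀ + 11 * 4 + F.L : ℕ) : ℝ) * ((F.L : ℝ) ^ 3 * ε (n - 1)) ≤ 28 * (F.L : ℝ) ^ 5 * B₁ * M₂ * a0Of F N M B₁ c₁ := by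
      have : 7 * (4 : ℕ) * (F.L : ℝ) ^ 2 * B₁ * ((M₀ + 11 * 4 + F.L : ℕ) : ℝ) * ((F.L : ℝ) ^ 3 * ε (n - 1)) =
          28 * (F.L : ℝ) ^ 5 * B₁ * ((M₀ + 11 * 4 + F.L : ℕ) : ℝ) * ε (n - 1) := by push_cast; ring
      rw [this]; gcongr
    set X : ℝ := 8 * (M₂ : ℝ) * N * (28 * (F.L : ℝ) ^ 5 * B₁ * M₂) with hX
    have hX0 : 0 ≤ X := by positivity
    have hXa : X * a0Of F N M B₁ c₁ < 1 := by
      calc X * a0Of F N M B₁ c₁ ≤ X * (1 / (X + 1)) := mul_le_mul_of_nonneg_left ha₀w hX0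
        _ < 1 := by rw [mul_one_div, div_lt_one (by positivity)]; linarith
    have hNr : (0 : ℝ) ≤ N := Nat.cast_nonneg N
    calc (2 * ((4 : ℕ) * ((F.L : ℝ) ^ n * ((M₀ + 11 * 4 + F.L : ℕ) : ℝ) - 1)) + 1) *
          ((F.P K).eta n * N * (7 * (4 : ℕ) * (F.L : ℝ) ^ 2 * B₁ * ((M₀ + 11 * 4 + F.L : ℕ) : ℝ) * ((F.L : ℝ) ^ 3 * ε (n - 1))))
        = ((2 * ((4 : ℕ) * ((F.L : ℝ) ^ n * ((M₀ + 11 * 4 + F.L : ℕ) : ℝ) - 1)) + 1) * (F.P K).eta n) *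
          (N * (7 * (4 : ℕ) * (F.L : ℝ) ^ 2 * B₁ * ((M₀ + 11 * 4 + F.L : ℕ) : ℝ) * ((F.L : ℝ) ^ 3 * ε (n - 1)))) := by ring
      _ ≤ (8 * ((M₀ + 11 * 4 + F.L : ℕ) : ℝ)) * (N * (28 * (F.L : ℝ) ^ 5 * B₁ * M₂ * a0Of F N M B₁ c₁)) := by
          gcongr
      _ ≤ (8 * (M₂ : ℝ)) * (N * (28 * (F.L : ℝ) ^ 5 * B₁ * M₂ * a0Of F N M B₁ c₁)) := by gcongr
      _ = X * a0Of F N M B₁ c₁ := by rw [hX]; ring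
      _ < 1 := hXa
      _ < 2 * Real.pi := by linarith [Real.pi_gt_three]
  obtain ⟨u, A, h1, h2, h3, h4, h4', A', hA', h5⟩ :=
    exists_localGauge152_153_cube_of_prop6 (P := F.P K) hd hB₁ hP6 U h17 h19 hn1 (by omega) hεn1 a hSN hcollar hc₁' h2π
  -- the letters at `b9Of·ε_n`
  have hbound : 2 * (7 * (F.P K).d * ((F.P K).L : ℝ) ^ 2 * B₁ * (propCube (F.P K) n hn1 M₀ a).M * (((F.P K).L : ℝ) ^ 3 * ε (n - 1))) <
      b9Of F M B₁ * ε n := by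
    rw [propCube_M, T4Family.P_d, T4Family.P_L, b9Of]
    have : 2 * (7 * (4 : ℕ) * (F.L : ℝ) ^ 2 * B₁ * ((M₀ + 11 * 4 + F.L : ℕ) : ℝ) * ((F.L : ℝ) ^ 3 * ε (n - 1))) =
        56 * (F.L : ℝ) ^ 5 * B₁ * ((M₀ + 11 * 4 + F.L : ℕ) : ℝ) * ε (n - 1) := by push_cast; ring
    rw [this]
    have hM₀r : ((M₀ + 11 * 4 + F.L : ℕ) : ℝ) ≤ (M₂ : ℝ) := by exact_mod_cast (by omega : M₀ + 11 * 4 + F.L ≤ M₂)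
    calc 56 * (F.L : ℝ) ^ 5 * B₁ * ((M₀ + 11 * 4 + F.L : ℕ) : ℝ) * ε (n - 1) ≤ 56 * (F.L : ℝ) ^ 5 * B₁ * M₂ * (2 * ε n) := by gcongr
      _ = (112 * (F.L : ℝ) ^ 5 * B₁ * M₂) * ε n := by ring
      _ < (112 * (F.L : ℝ) ^ 5 * B₁ * ((F.L * M + 44 + F.L : ℕ) : ℝ) + 1) * ε n := by
          rw [hM₂]; exact mul_lt_mul_of_pos_right (lt_add_one _) hεn
  exact ⟨u, A, h1, fun b hb => (h2 b hb).trans_lt hbound, fun q hq => (h3 q hq).trans_lt hbound, fun b hb => (h4 b hb).trans_lt hbound,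
    fun b hb => (h4' b hb).trans_lt hbound, A', hA', h5⟩

/-- ★★ **[15] THM 1 (9) line 1 AND (10) — BOTH MEMBERS — WITH THE GAUGE CONDITION OF (9)'s `u` FOR THE LIFT, FOR CRITICAL CONFIGURATIONS ⟸ [15] PROP. 8's TOP STEP ∧ [6]
PROP. 6 AT THE MEMBER** — 34c's `gauge9R10_of_prop8TopStep_of_gauge152R10` (binder block of `Gauge9RegSepTopStepR10`: separated `s`, `0 < ν.M₁`, floor `(11·4 + 3L)·L ≤ ν.M₁`,
`1 ≤ k`, thresholds `0 < δ_n ≤ a₁`, `B₃δ_n ≤ ε₀ ≤ a₀`, two-sided 2-comparable, a (7)-regular datum `W`, `U` in the (1.7)∕(1.9)-Top class at `ε₀` on the fibre of `W`, CRITICAL on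
the fibre; `B₃ > 0`, `B₃a₁ ≤ a0Of`) re-run through `gauge152_153_of_prop6` at the radii `B₃δ_•` of (8): on every non-wrapping grid cube `□ ⊆ Ω_n` of the two families
(`M₀ ∈ {M, LM}` at scale `n`) an `SU(N)` gauge `u`, a potential `A` with `(ι∘U)^{ι∘u} = e^{iη_nA}` and the FOUR (152) letters `< b9Of·B₃·δ_n` — print's (9) «|A| <
B₃Mε₁(L^jη)⁻¹, |∇^ηA| < B₃Mε₁(L^jη)⁻²» (no Hölder member) and (10) «|∂^{η*}∂^ηA|, |Δ^ηA| < B₃Mε₁(L^jη)⁻³» in the record's letters — and a `ℤᵈ` lift `A′` of `A` in the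
(153)-gauge of the Prop.-6 cube datum.  V15∕V18 stub 1's fact `Prop8RegSepTopStep` is the HYPOTHESIS `h8`, Prop. 6 at the member the HYPOTHESIS `hP6`.
[cite: Balaban1985Variational, Thm 1 (8)–(10) p.279, Sect. F pp.300–305, Prop. 8 p.304, (152)–(153) p.301; Balaban1985RegularSpaces, Prop. 6 p.99] -/
theorem gauge9_152_153_of_prop8TopStep_of_prop6 {B₁ c₁ B₃ a₀ a₁ : ℝ} (hB₁ : 0 ≤ B₁) (hc₁ : 0 < c₁)
    (hP6 : letI : CStarAlgebra (MatA N) := {}; B8.Prop6Printed 4 (F.L : ℝ) B₁ c₁ (fun i : ZdIdx 4 F.L => zdCub (MatA N) F.L i)) (M : ℕ)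
    (h8 : Prop8RegSepTopStep F N (fun ν K Ω => suppDomOfRecord F ν K Ω) B₃ a₀ a₁) (hB₃ : 0 < B₃) (ha : B₃ * a₁ ≤ a0Of F N M B₁ c₁)
    (ν : Stage7Numerics) (g : ℕ → ℝ) (K k : ℕ) (s : SeqOfRecord F ν M g K k) (hsep : Sect2.SeqSeparated ν.M₁ s) (hM₁ : 0 < ν.M₁)
    (hfloor : (11 * 4 + 3 * F.L) * F.L ≤ ν.M₁) (hk : 1 ≤ k) (ε₀ : ℝ) (δ : ℕ → ℝ)
    (hδ : ∀ m, m ≤ k → 0 < δ m ∧ δ m ≤ a₁ ∧ B₃ * δ m ≤ ε₀) (hcomp : ∀ m, m < k → δ m ≤ 2 * δ (m + 1)) (hcomp' : ∀ m, m < k → δ (m + 1) ≤ 2 * δ m)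
    (hε₀ : ε₀ ≤ a₀) (W : MSField (F.P K) (SU N)) (h7 : Sect2.DataSmall7PTop (avOfRecord F N K) s.Ω (suppDomOfRecord F ν K s.Ω) k δ W)
    (U : GaugeField (F.P K) 0 (SU N))
    (h17 : ∀ m, m ≤ k → PlaqSmallOn (Sect2.omegaPlaqsTop s.Ω (suppDomOfRecord F ν K s.Ω) m) (ε₀ * (F.P K).eta m ^ 2) U)
    (h19 : Sect2.CoDivClassOnTop s.Ω (suppDomOfRecord F ν K s.Ω) k ε₀ U) (hfib : AgreeOn (genSet s.Ω k) (avgFamily (avOfRecord F N K) U) W)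
    (hcrit : IsCritOnFibre F N K (genSet s.Ω k) W U)
    {n : ℕ} (hn1 : 1 ≤ n) (hnk : n ≤ k) {M₀ : ℕ} (hM₀ : M₀ = M ∨ M₀ = F.L * M)
    (hSN : ((side (F.P K).L M₀ n : ℕ) : ℤ) < (F.P K).sitesPerDir 0)
    (a : Pt (F.P K).d) (hΩ : cubeEnl (F.P K) (side (F.P K).L M₀ n) a 0 ⊆ s.Ω n) :
    ∃ u : GaugeTransf (F.P K) 0 (SU N), ∃ A : PBond (F.P K) 0 → MatA N,
      (∀ b ∈ (Sect2.regionOfSet (F.P K) (cubeEnl (F.P K) (side (F.P K).L M₀ n) a 0)).bonds,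
          gaugeU (fun x => ιSU N (u x)) (fun b' => ιSU N (U b')) b = expI ((F.P K).eta n) (A b)) ∧
      (∀ b ∈ (Sect2.regionOfSet (F.P K) (cubeEnl (F.P K) (side (F.P K).L M₀ n) a 0)).bonds, ‖A b‖ < b9Of F M B₁ * B₃ * δ n) ∧
      (∀ q ∈ (Sect2.regionOfSet (F.P K) (cubeEnl (F.P K) (side (F.P K).L M₀ n) a 0)).dpairs,
          ‖grad ((F.P K).eta n) q.2.1 (fun y => A ⟨y, q.2.2⟩) q.1‖ < b9Of F M B₁ * B₃ * δ n) ∧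
      (∀ b ∈ Sect2.bondsDeep (cubeEnl (F.P K) (side (F.P K).L M₀ n) a 0), ‖Sect2.codiffCurlA ((F.P K).eta n) A b.src b.dir‖ < b9Of F M B₁ * B₃ * δ n) ∧
      (∀ b ∈ Sect2.bondsDeep (cubeEnl (F.P K) (side (F.P K).L M₀ n) a 0),
          ‖∑ ν' : Fin (F.P K).d, (((F.P K).eta n : ℝ) : ℂ)⁻¹ •
              (grad ((F.P K).eta n) ν' (fun y => A ⟨y, b.dir⟩) (b.src.unshift ν') - grad ((F.P K).eta n) ν' (fun y => A ⟨y, b.dir⟩) b.src)‖ <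
            b9Of F M B₁ * B₃ * δ n) ∧
      ∃ A' : B7Prop1Explicit.Site (F.P K).d → Fin (F.P K).d → MatA N,
        (∀ x, x ∈ cubeExt (side (F.P K).L M₀ n) a 0 → ∀ μ, A ⟨cover (F.P K) x, μ⟩ = A' x μ) ∧
        IsLandau138 (F.P K).L (propCube (F.P K) n hn1 M₀ a).k ((F.P K).eta n) ((propCube (F.P K) n hn1 M₀ a).sq 0) (propCube (F.P K) n hn1 M₀ a).lamS
          (1 : B7Prop1Explicit.Site (F.P K).d → Fin (F.P K).d → (MatA N)ˣ) A' := by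
  obtain ⟨h8p, h8c⟩ := h8 ν M g K k s hsep hM₁ hk ε₀ δ hδ hcomp hcomp' hε₀ W h7 U h17 h19 hfib hcrit
  have hε : ∀ m, m ≤ k → 0 < B₃ * δ m ∧ B₃ * δ m ≤ a0Of F N M B₁ c₁ := fun m hm =>
    ⟨mul_pos hB₃ (hδ m hm).1, (mul_le_mul_of_nonneg_left (hδ m hm).2.1 hB₃.le).trans ha⟩
  have hc1 : ∀ m, m < k → B₃ * δ m ≤ 2 * (B₃ * δ (m + 1)) := fun m hm => by
    have := mul_le_mul_of_nonneg_left (hcomp m hm) hB₃.le; linarith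
  have h := gauge152_153_of_prop6 hB₁ hc₁ hP6 M ν g K k s hsep hfloor (fun m => B₃ * δ m) hε hc1 U h8p h8c hn1 hnk hM₀ hSN a hΩ
  rw [show b9Of F M B₁ * B₃ * δ n = b9Of F M B₁ * (B₃ * δ n) by ring]
  exact h

end Literature.MathematicalPhysics.QuantumFieldTheory.Balaban1983to89.Node00

end
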